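import Mathlib

/-!
# The divided-square lemma for alternating forms (pub-hsemireg, S4-PUSH corner 2, S4-PR-50 (D3))

Kernel leg for the pencil lemma (D3) «DIVIDED SQUARES» of PREREG-S2-17 §1 ∕ memo
`s4push/search-2/g10/DUAL4-search-2-g10.md` §1 (cell `pub-hsemireg`, seat s4-search-2; the same step, with an
independent pencil proof and an exhaustive machine check over `𝔽₂` in dimensions 6 and 8, is §4 (iii) of
gs-eng-2's LEMMA DUAL-4′, `general-structure/XCHECK-K0-gs2.md`), filed by s4-search-2 gen 12.

**Setting.** Let `β` be an alternating bilinear form on a free module with a symplectic-type basis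
`a₁, b₁, …, aₙ, bₙ` (slot `i` = the plane `⟨aᵢ, bᵢ⟩`, `hᵢ := aᵢ* ∧ bᵢ*`).  The divided square `β^[2] = ½ β ∧ β`
is defined over ANY commutative ring (in particular in characteristic `2`) by its Pfaffian coordinates: the
coefficient of `x_k* ∧ x_l* ∧ x_m* ∧ x_q*` (`k < l < m < q` in the basis order) is
`Pf_{klmq}(β) = β(x_k,x_l) β(x_m,x_q) − β(x_k,x_m) β(x_l,x_q) + β(x_k,x_q) β(x_l,x_m)`.
For a graph `E` on the slots put `Ω_E := Σ_{ij ∈ E} hᵢ ∧ hⱼ`; its coefficient is `1` on `{aᵢ, bᵢ, aⱼ, bⱼ}`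
(`ij ∈ E`) and `0` on every other 4-subset of the basis.  (D3) says: for a unit `κ`, the 4-form `κ Ω_E` is a
divided square `β^[2]` iff `E = ∅`, or `E` is a single edge, or `E = K_m` (`m ≥ 3`) with `κ` a square; in
particular a STAR with `≥ 2` leaves is never a divided square.  This is the step behind COROLLARY (D5)(a)
(the 5-leaf star kills all 1 004 R4-undecided `p = 2` pairs of S4-PR-42, RESULT S4-PR-50) and behind the
`κ`-square test of the `p = 3` congruence tower (S4-PR-52).

**What is proved here, and why it covers every dimension and every prime.**  Both non-realisability
clauses are statements about SIX basis vectors only: a star with centre slot `1` and leaves `2, 3` (restrict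
any star with `≥ 2` leaves to its centre and two leaves), and the triangle `K₃` on slots `1, 2, 3` (restrict
any `K_m`, `m ≥ 3`, to three of its slots) — restriction to the span of `a₁,b₁,a₂,b₂,a₃,b₃` commutes with
`β ↦ β^[2]` coefficientwise, so the fifteen Pfaffian coordinates inside those six vectors must already show
the pattern.  We therefore work with an arbitrary function `β : ι → ι → R` on an arbitrary index type and
six indices `a₁ b₁ a₂ b₂ a₃ b₃ : ι` (only the fifteen values `β x y` with `x` before `y` in the order
`a₁ b₁ a₂ b₂ a₃ b₃` occur, so neither antisymmetry nor distinctness hypotheses are needed), over an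
arbitrary commutative ring `R`:

* `pow_four_eq_zero_of_pfaffian_star`: the star pattern (`κ` on `{a₁,b₁,a₂,b₂}` and `{a₁,b₁,a₃,b₃}`, `0` on
  the other 4-subsets) forces `κ ^ 4 = 0` — an explicit ideal-membership certificate
  (`linear_combination`); hence `κ = 0` in any reduced ring (`eq_zero_of_pfaffian_star`), e.g. in `𝔽_p`:
  a star with two or more leaves is never `κ⁻¹ β^[2]` for a unit `κ`.
* `cross_eq_zero_of_pfaffian_clique` ∕ `diag_eq_of_pfaffian_clique`: the `K₃` pattern (`κ` on the three
  slot pairs, `0` elsewhere) with `κ ≠ 0` in a domain forces `β` to be `μ · (h₁ + h₂ + h₃)` on these six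
  vectors (all twelve cross-slot values vanish, `β a₁ b₁ = β a₂ b₂ = β a₃ b₃ =: μ`) and `κ = μ ^ 2`; hence
  `isSquare_of_pfaffian_clique`: `κ` is a square (the case `κ = 0` being trivial).

The mechanism is the pencil one: the Pfaffian coordinates `Pf_{k l m q}` for fixed `k` are the coefficients
of the 3-form `ι_{x_k} β^[2] = β(x_k, ·) ∧ β`, and `β(x_k,·) ∧ (β(x_k,·) ∧ β) = 0` yields, pattern by
pattern, `κ · β(x,y) = 0` for every cross-slot pair — each such identity is a four-term syzygy among the
hypotheses with linear coefficients.  The realisability directions of (D3) (`E = ∅`: `β = 0`; single edge: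
`β = κ h₁ + h₂`; `K_m` with `κ = μ²`: `β = μ D_m`) are immediate and are not needed by the sieve (D4),
which only ever uses NON-realisability to declare a route DUAL-DEAD.

**Convention check (kernel).**  Section `PfaffianConvention` proves, in Mathlib's `ExteriorAlgebra R M` for an
arbitrary module, that `(Σ_{i<j} β_ij eᵢ∧eⱼ)² = 2·Pf₀₁₂₃(β)·e₀∧e₁∧e₂∧e₃` for any four vectors
(`sq_eq_two_mul_pfaffian_smul`): the Pfaffian coordinate used below is the coefficient of the divided square,
with exactly these signs.

Honest framing: elementary multilinear algebra (theorems only, count-neutral); a kernel check of one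
pencil step of a CLASS-LEVEL necessary-condition sieve at the special fibre; nothing here bears on
HC ∕ HC_CM ∕ HC_AV, and nothing here is an object, a σ or a Hodge statement.
-/

namespace Summit.Ventures.HSemireg.DividedSquareLemma

variable {R : Type*} [CommRing R]

section PfaffianConvention

/-! ### 0. The Pfaffian coordinate of the divided square (convention check in `ExteriorAlgebra`) -/

open ExteriorAlgebra (ι)

variable {M : Type*} [AddCommGroup M] [Module R M]

/-- Anticommutation of generators: `ι a * ι b = -(ι b * ι a)` (from Mathlib's `ExteriorAlgebra.ι_add_mul_swap`). -/
theorem ι_mul_ι_eq_neg (a b : M) : ι R a * ι R b = -(ι R b * ι R a) :=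
  eq_neg_of_add_eq_zero_left (ExteriorAlgebra.ι_add_mul_swap a b)

/-- A product of two generators is central: `(ι u * ι v) * x = x * (ι u * ι v)` (even elements of the exterior
algebra are central). [cite: BourbakiAlgebre1a3, Ch. III §7 no. 1] -/
theorem ι_mul_ι_mul_comm (u v : M) (x : ExteriorAlgebra R M) :
    ι R u * ι R v * x = x * (ι R u * ι R v) := by
  induction x using ExteriorAlgebra.induction with
  | algebraMap r => exact (Algebra.commutes r _).symm
  | ι w =>
    rw [mul_assoc, ι_mul_ι_eq_neg v w, mul_neg, ← mul_assoc, ι_mul_ι_eq_neg u w, neg_mul, neg_neg,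
      mul_assoc]
  | mul x y hx hy => rw [← mul_assoc, hx, mul_assoc, hy, mul_assoc]
  | add x y hx hy => rw [mul_add, add_mul, hx, hy]

/-- `(ι x ι b)(ι x ι d) = 0`. -/
theorem ι₄_eq_zero_13 (x b d : M) : ι R x * ι R b * (ι R x * ι R d) = 0 := by
  rw [ι_mul_ι_eq_neg x b, neg_mul, mul_assoc, ← mul_assoc (ι R x) (ι R x), ExteriorAlgebra.ι_sq_zero,
    zero_mul, mul_zero, neg_zero]

/-- `(ι x ι b)(ι c ι x) = 0`. -/
theorem ι₄_eq_zero_14 (x b c : M) : ι R x * ι R b * (ι R c * ι R x) = 0 := by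
  rw [ι_mul_ι_eq_neg c x, mul_neg, ι₄_eq_zero_13, neg_zero]

/-- `(ι a ι x)(ι x ι d) = 0`. -/
theorem ι₄_eq_zero_23 (a x d : M) : ι R a * ι R x * (ι R x * ι R d) = 0 := by
  rw [mul_assoc, ← mul_assoc (ι R x) (ι R x), ExteriorAlgebra.ι_sq_zero, zero_mul, mul_zero]

/-- `(ι a ι x)(ι c ι x) = 0`. -/
theorem ι₄_eq_zero_24 (a x c : M) : ι R a * ι R x * (ι R c * ι R x) = 0 := by
  rw [ι_mul_ι_eq_neg c x, mul_neg, ι₄_eq_zero_23, neg_zero]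

/-- **`B ∧ B = 2 · Pf · e₀∧e₁∧e₂∧e₃` — the Pfaffian coordinate IS the coefficient of the divided square.**  In
the exterior algebra of any module over any commutative ring, for any four vectors `e₀ e₁ e₂ e₃` and any six
coefficients, the square of the 2-vector `B = Σ_{i<j} β_ij · eᵢ∧eⱼ` equals
`2 (β₀₁β₂₃ − β₀₂β₁₃ + β₀₃β₁₂) · e₀∧e₁∧e₂∧e₃`.  So the divided square `B^[2] = ½ B∧B` — defined integrally by
this identity, in every characteristic — has coefficient `Pf₀₁₂₃(β) = β₀₁β₂₃ − β₀₂β₁₃ + β₀₃β₁₂` on `e₀∧e₁∧e₂∧e₃`,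
which is the coordinate used in the hypotheses of the theorems below (for a 2-form on more basis vectors the
`e_k∧e_l∧e_m∧e_q`-coefficient of `B∧B` involves only the six coefficients inside `{k,l,m,q}`: every other
product of two basis 2-vectors contains a repeated or a foreign basis vector).  Thirty of the thirty-six
products vanish by a repeated generator; the six disjoint ones are `± e₀e₁e₂e₃` with the displayed signs. -/
theorem sq_eq_two_mul_pfaffian_smul (e₀ e₁ e₂ e₃ : M) (β₀₁ β₀₂ β₀₃ β₁₂ β₁₃ β₂₃ : R) :
    (β₀₁ • (ι R e₀ * ι R e₁) + β₀₂ • (ι R e₀ * ι R e₂) + β₀₃ • (ι R e₀ * ι R e₃) +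
        β₁₂ • (ι R e₁ * ι R e₂) + β₁₃ • (ι R e₁ * ι R e₃) + β₂₃ • (ι R e₂ * ι R e₃)) ^ 2 =
      (2 * (β₀₁ * β₂₃ - β₀₂ * β₁₃ + β₀₃ * β₁₂)) • (ι R e₀ * ι R e₁ * (ι R e₂ * ι R e₃)) := by
  have r2301 : ι R e₂ * ι R e₃ * (ι R e₀ * ι R e₁) = ι R e₀ * ι R e₁ * (ι R e₂ * ι R e₃) :=
    (ι_mul_ι_mul_comm e₀ e₁ _).symm
  have r0213 : ι R e₀ * ι R e₂ * (ι R e₁ * ι R e₃) = -(ι R e₀ * ι R e₁ * (ι R e₂ * ι R e₃)) := by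
    rw [mul_assoc, ← mul_assoc (ι R e₂), ι_mul_ι_eq_neg e₂ e₁, neg_mul, mul_neg, mul_assoc, ← mul_assoc]
  have r1302 : ι R e₁ * ι R e₃ * (ι R e₀ * ι R e₂) = -(ι R e₀ * ι R e₁ * (ι R e₂ * ι R e₃)) := by
    rw [ι_mul_ι_mul_comm e₁ e₃, r0213]
  have r0312 : ι R e₀ * ι R e₃ * (ι R e₁ * ι R e₂) = ι R e₀ * ι R e₁ * (ι R e₂ * ι R e₃) := by
    rw [mul_assoc, ← ι_mul_ι_mul_comm e₁ e₂ (ι R e₃), mul_assoc, ← mul_assoc]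
  have r1203 : ι R e₁ * ι R e₂ * (ι R e₀ * ι R e₃) = ι R e₀ * ι R e₁ * (ι R e₂ * ι R e₃) := by
    rw [ι_mul_ι_mul_comm e₁ e₂, r0312]
  rw [sq]
  simp only [add_mul, mul_add, smul_mul_assoc, mul_smul_comm, smul_smul, ι₄_eq_zero_13, ι₄_eq_zero_14,
    ι₄_eq_zero_23, ι₄_eq_zero_24, r2301, r0213, r1302, r0312, r1203, smul_zero, add_zero, zero_add,
    smul_neg]
  module

end PfaffianConvention

section Sieve

/-! ### 1. Stars and cliques in Pfaffian coordinates -/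

variable {ι : Type*}

/-- **Stars are never divided squares (certificate form).**  If the fifteen Pfaffian coordinates of `β`
on six indices `a₁ b₁ a₂ b₂ a₃ b₃` show the STAR pattern — value `κ` on `{a₁,b₁,a₂,b₂}` and on
`{a₁,b₁,a₃,b₃}`, value `0` on `{a₂,b₂,a₃,b₃}` and on the mixed 4-subsets (the two mixed subsets avoiding
`a₁` and containing `b₁, a₃, b₃` are not even needed) — then `κ ^ 4 = 0`, over any commutative ring.
Pencil source: PREREG-S2-17 §1 (D3) ∕ memo DUAL4-search-2-g10 §1 (D3), «STAR with ≥ 2 leaves … never». -/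
theorem pow_four_eq_zero_of_pfaffian_star (β : ι → ι → R) (a₁ b₁ a₂ b₂ a₃ b₃ : ι) (κ : R)
    (h1234 : β a₁ b₁ * β a₂ b₂ - β a₁ a₂ * β b₁ b₂ + β a₁ b₂ * β b₁ a₂ = κ)
    (h1235 : β a₁ b₁ * β a₂ a₃ - β a₁ a₂ * β b₁ a₃ + β a₁ a₃ * β b₁ a₂ = 0)
    (h1236 : β a₁ b₁ * β a₂ b₃ - β a₁ a₂ * β b₁ b₃ + β a₁ b₃ * β b₁ a₂ = 0)
    (h1245 : β a₁ b₁ * β b₂ a₃ - β a₁ b₂ * β b₁ a₃ + β a₁ a₃ * β b₁ b₂ = 0)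
    (h1246 : β a₁ b₁ * β b₂ b₃ - β a₁ b₂ * β b₁ b₃ + β a₁ b₃ * β b₁ b₂ = 0)
    (h1256 : β a₁ b₁ * β a₃ b₃ - β a₁ a₃ * β b₁ b₃ + β a₁ b₃ * β b₁ a₃ = κ)
    (h1345 : β a₁ a₂ * β b₂ a₃ - β a₁ b₂ * β a₂ a₃ + β a₁ a₃ * β a₂ b₂ = 0)
    (h1346 : β a₁ a₂ * β b₂ b₃ - β a₁ b₂ * β a₂ b₃ + β a₁ b₃ * β a₂ b₂ = 0)
    (h1356 : β a₁ a₂ * β a₃ b₃ - β a₁ a₃ * β a₂ b₃ + β a₁ b₃ * β a₂ a₃ = 0)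
    (h1456 : β a₁ b₂ * β a₃ b₃ - β a₁ a₃ * β b₂ b₃ + β a₁ b₃ * β b₂ a₃ = 0)
    (h2345 : β b₁ a₂ * β b₂ a₃ - β b₁ b₂ * β a₂ a₃ + β b₁ a₃ * β a₂ b₂ = 0)
    (h2346 : β b₁ a₂ * β b₂ b₃ - β b₁ b₂ * β a₂ b₃ + β b₁ b₃ * β a₂ b₂ = 0)
    (h3456 : β a₂ b₂ * β a₃ b₃ - β a₂ a₃ * β b₂ b₃ + β a₂ b₃ * β b₂ a₃ = 0) :
    κ ^ 4 = 0 := by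
  -- cross-slot values are κ-torsion: β(x,·) ∧ (β(x,·) ∧ β) = 0 read through the hypotheses
  have e13 : κ * β a₁ a₂ = 0 := by
    linear_combination -β a₁ b₃ * h1235 + β a₁ a₃ * h1236 - β a₁ a₂ * h1256 + β a₁ b₁ * h1356
  have e14 : κ * β a₁ b₂ = 0 := by
    linear_combination -β a₁ b₃ * h1245 + β a₁ a₃ * h1246 - β a₁ b₂ * h1256 + β a₁ b₁ * h1456
  have e15 : κ * β a₁ a₃ = 0 := by
    linear_combination -β a₁ a₃ * h1234 + β a₁ b₂ * h1235 - β a₁ a₂ * h1245 + β a₁ b₁ * h1345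
  have e16 : κ * β a₁ b₃ = 0 := by
    linear_combination -β a₁ b₃ * h1234 + β a₁ b₂ * h1236 - β a₁ a₂ * h1246 + β a₁ b₁ * h1346
  have e35 : κ * β a₂ a₃ = 0 := by
    linear_combination -β a₂ a₃ * h1234 + β a₂ b₂ * h1235 - β b₁ a₂ * h1345 + β a₁ a₂ * h2345
  have e36 : κ * β a₂ b₃ = 0 := by
    linear_combination -β a₂ b₃ * h1234 + β a₂ b₂ * h1236 - β b₁ a₂ * h1346 + β a₁ a₂ * h2346
  -- the two edges give κ² = κ β₁₂ β₃₄ = κ β₁₂ β₅₆; the non-edge {2,3} gives κ² β₃₄ β₅₆ = 0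
  have s1 : κ ^ 2 = κ * β a₁ b₁ * β a₂ b₂ := by
    linear_combination (-κ) * h1234 - β b₁ b₂ * e13 + β b₁ a₂ * e14
  have s2 : κ ^ 2 = κ * β a₁ b₁ * β a₃ b₃ := by
    linear_combination (-κ) * h1256 - β b₁ b₃ * e15 + β b₁ a₃ * e16
  have s3 : κ ^ 2 * β a₂ b₂ * β a₃ b₃ = 0 := by
    linear_combination κ ^ 2 * h3456 + κ * β b₂ b₃ * e35 - κ * β b₂ a₃ * e36
  linear_combination κ ^ 2 * s1 + κ * β a₁ b₁ * β a₂ b₂ * s2 + β a₁ b₁ ^ 2 * s3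

/-- **Stars are never divided squares.**  In a reduced commutative ring (e.g. any field `𝔽_p`), the STAR
pattern of Pfaffian coordinates on six indices forces `κ = 0`: for a unit `κ`, `κ · (h₁h₂ + h₁h₃ + …)`
(a star with at least two leaves, in any number of slots) is not of the form `β^[2]`.
Pencil source: PREREG-S2-17 §1 (D3); used in COROLLARY (D5)(a) (the 5-leaf star; RESULT S4-PR-50). -/
theorem eq_zero_of_pfaffian_star [IsReduced R] (β : ι → ι → R) (a₁ b₁ a₂ b₂ a₃ b₃ : ι) (κ : R)
    (h1234 : β a₁ b₁ * β a₂ b₂ - β a₁ a₂ * β b₁ b₂ + β a₁ b₂ * β b₁ a₂ = κ)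
    (h1235 : β a₁ b₁ * β a₂ a₃ - β a₁ a₂ * β b₁ a₃ + β a₁ a₃ * β b₁ a₂ = 0)
    (h1236 : β a₁ b₁ * β a₂ b₃ - β a₁ a₂ * β b₁ b₃ + β a₁ b₃ * β b₁ a₂ = 0)
    (h1245 : β a₁ b₁ * β b₂ a₃ - β a₁ b₂ * β b₁ a₃ + β a₁ a₃ * β b₁ b₂ = 0)
    (h1246 : β a₁ b₁ * β b₂ b₃ - β a₁ b₂ * β b₁ b₃ + β a₁ b₃ * β b₁ b₂ = 0)
    (h1256 : β a₁ b₁ * β a₃ b₃ - β a₁ a₃ * β b₁ b₃ + β a₁ b₃ * β b₁ a₃ = κ)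
    (h1345 : β a₁ a₂ * β b₂ a₃ - β a₁ b₂ * β a₂ a₃ + β a₁ a₃ * β a₂ b₂ = 0)
    (h1346 : β a₁ a₂ * β b₂ b₃ - β a₁ b₂ * β a₂ b₃ + β a₁ b₃ * β a₂ b₂ = 0)
    (h1356 : β a₁ a₂ * β a₃ b₃ - β a₁ a₃ * β a₂ b₃ + β a₁ b₃ * β a₂ a₃ = 0)
    (h1456 : β a₁ b₂ * β a₃ b₃ - β a₁ a₃ * β b₂ b₃ + β a₁ b₃ * β b₂ a₃ = 0)
    (h2345 : β b₁ a₂ * β b₂ a₃ - β b₁ b₂ * β a₂ a₃ + β b₁ a₃ * β a₂ b₂ = 0)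
    (h2346 : β b₁ a₂ * β b₂ b₃ - β b₁ b₂ * β a₂ b₃ + β b₁ b₃ * β a₂ b₂ = 0)
    (h3456 : β a₂ b₂ * β a₃ b₃ - β a₂ a₃ * β b₂ b₃ + β a₂ b₃ * β b₂ a₃ = 0) :
    κ = 0 :=
  IsNilpotent.eq_zero ⟨4, pow_four_eq_zero_of_pfaffian_star β a₁ b₁ a₂ b₂ a₃ b₃ κ h1234 h1235 h1236
    h1245 h1246 h1256 h1345 h1346 h1356 h1456 h2345 h2346 h3456⟩

/-- **The triangle pattern kills every cross-slot value.**  If the fifteen Pfaffian coordinates of `β` on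
`a₁ b₁ a₂ b₂ a₃ b₃` show the `K₃` pattern — value `κ` on the three slot pairs `{aᵢ,bᵢ,aⱼ,bⱼ}`, `0` on the
twelve mixed 4-subsets (the coordinate on `{a₂,b₂,a₃,b₃}` is not needed for this step) — and `κ ≠ 0` in a
domain, then all twelve cross-slot values `β x y` (`x`, `y` in different slots) vanish.
Pencil source: PREREG-S2-17 §1 (D3), case `K_m`. -/
theorem cross_eq_zero_of_pfaffian_clique [NoZeroDivisors R] (β : ι → ι → R) (a₁ b₁ a₂ b₂ a₃ b₃ : ι)
    (κ : R) (hκ : κ ≠ 0)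
    (h1234 : β a₁ b₁ * β a₂ b₂ - β a₁ a₂ * β b₁ b₂ + β a₁ b₂ * β b₁ a₂ = κ)
    (h1235 : β a₁ b₁ * β a₂ a₃ - β a₁ a₂ * β b₁ a₃ + β a₁ a₃ * β b₁ a₂ = 0)
    (h1236 : β a₁ b₁ * β a₂ b₃ - β a₁ a₂ * β b₁ b₃ + β a₁ b₃ * β b₁ a₂ = 0)
    (h1245 : β a₁ b₁ * β b₂ a₃ - β a₁ b₂ * β b₁ a₃ + β a₁ a₃ * β b₁ b₂ = 0)
    (h1246 : β a₁ b₁ * β b₂ b₃ - β a₁ b₂ * β b₁ b₃ + β a₁ b₃ * β b₁ b₂ = 0)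
    (h1256 : β a₁ b₁ * β a₃ b₃ - β a₁ a₃ * β b₁ b₃ + β a₁ b₃ * β b₁ a₃ = κ)
    (h1345 : β a₁ a₂ * β b₂ a₃ - β a₁ b₂ * β a₂ a₃ + β a₁ a₃ * β a₂ b₂ = 0)
    (h1346 : β a₁ a₂ * β b₂ b₃ - β a₁ b₂ * β a₂ b₃ + β a₁ b₃ * β a₂ b₂ = 0)
    (h1356 : β a₁ a₂ * β a₃ b₃ - β a₁ a₃ * β a₂ b₃ + β a₁ b₃ * β a₂ a₃ = 0)
    (h1456 : β a₁ b₂ * β a₃ b₃ - β a₁ a₃ * β b₂ b₃ + β a₁ b₃ * β b₂ a₃ = 0)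
    (h2345 : β b₁ a₂ * β b₂ a₃ - β b₁ b₂ * β a₂ a₃ + β b₁ a₃ * β a₂ b₂ = 0)
    (h2346 : β b₁ a₂ * β b₂ b₃ - β b₁ b₂ * β a₂ b₃ + β b₁ b₃ * β a₂ b₂ = 0)
    (h2356 : β b₁ a₂ * β a₃ b₃ - β b₁ a₃ * β a₂ b₃ + β b₁ b₃ * β a₂ a₃ = 0)
    (h2456 : β b₁ b₂ * β a₃ b₃ - β b₁ a₃ * β b₂ b₃ + β b₁ b₃ * β b₂ a₃ = 0) :
    β a₁ a₂ = 0 ∧ β a₁ b₂ = 0 ∧ β a₁ a₃ = 0 ∧ β a₁ b₃ = 0 ∧ β b₁ a₂ = 0 ∧ β b₁ b₂ = 0 ∧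
      β b₁ a₃ = 0 ∧ β b₁ b₃ = 0 ∧ β a₂ a₃ = 0 ∧ β a₂ b₃ = 0 ∧ β b₂ a₃ = 0 ∧ β b₂ b₃ = 0 := by
  have e13 : κ * β a₁ a₂ = 0 := by
    linear_combination -β a₁ b₃ * h1235 + β a₁ a₃ * h1236 - β a₁ a₂ * h1256 + β a₁ b₁ * h1356
  have e14 : κ * β a₁ b₂ = 0 := by
    linear_combination -β a₁ b₃ * h1245 + β a₁ a₃ * h1246 - β a₁ b₂ * h1256 + β a₁ b₁ * h1456
  have e15 : κ * β a₁ a₃ = 0 := by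
    linear_combination -β a₁ a₃ * h1234 + β a₁ b₂ * h1235 - β a₁ a₂ * h1245 + β a₁ b₁ * h1345
  have e16 : κ * β a₁ b₃ = 0 := by
    linear_combination -β a₁ b₃ * h1234 + β a₁ b₂ * h1236 - β a₁ a₂ * h1246 + β a₁ b₁ * h1346
  have e23 : κ * β b₁ a₂ = 0 := by
    linear_combination -β b₁ b₃ * h1235 + β b₁ a₃ * h1236 - β b₁ a₂ * h1256 + β a₁ b₁ * h2356
  have e24 : κ * β b₁ b₂ = 0 := by
    linear_combination -β b₁ b₃ * h1245 + β b₁ a₃ * h1246 - β b₁ b₂ * h1256 + β a₁ b₁ * h2456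
  have e25 : κ * β b₁ a₃ = 0 := by
    linear_combination -β b₁ a₃ * h1234 + β b₁ b₂ * h1235 - β b₁ a₂ * h1245 + β a₁ b₁ * h2345
  have e26 : κ * β b₁ b₃ = 0 := by
    linear_combination -β b₁ b₃ * h1234 + β b₁ b₂ * h1236 - β b₁ a₂ * h1246 + β a₁ b₁ * h2346
  have e35 : κ * β a₂ a₃ = 0 := by
    linear_combination -β a₂ a₃ * h1234 + β a₂ b₂ * h1235 - β b₁ a₂ * h1345 + β a₁ a₂ * h2345
  have e36 : κ * β a₂ b₃ = 0 := by
    linear_combination -β a₂ b₃ * h1234 + β a₂ b₂ * h1236 - β b₁ a₂ * h1346 + β a₁ a₂ * h2346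
  have e45 : κ * β b₂ a₃ = 0 := by
    linear_combination -β b₂ a₃ * h1234 + β a₂ b₂ * h1245 - β b₁ b₂ * h1345 + β a₁ b₂ * h2345
  have e46 : κ * β b₂ b₃ = 0 := by
    linear_combination -β b₂ b₃ * h1234 + β a₂ b₂ * h1246 - β b₁ b₂ * h1346 + β a₁ b₂ * h2346
  have z : ∀ t : R, κ * t = 0 → t = 0 := fun t ht => (mul_eq_zero.mp ht).resolve_left hκ
  exact ⟨z _ e13, z _ e14, z _ e15, z _ e16, z _ e23, z _ e24, z _ e25, z _ e26, z _ e35, z _ e36,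
    z _ e45, z _ e46⟩

/-- **The triangle pattern forces `β = μ · D₃` and `κ = μ²`.**  Under the `K₃` pattern with `κ ≠ 0` in a
domain, the three diagonal values agree, `β a₁ b₁ = β a₂ b₂ = β a₃ b₃ =: μ`, and `κ = μ ^ 2`; together
with `cross_eq_zero_of_pfaffian_clique` this says `β = μ (h₁ + h₂ + h₃)` on the six vectors.
Pencil source: PREREG-S2-17 §1 (D3): «B̄ = μ D_m, and κ = μ²». -/
theorem diag_eq_of_pfaffian_clique [NoZeroDivisors R] (β : ι → ι → R) (a₁ b₁ a₂ b₂ a₃ b₃ : ι)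
    (κ : R) (hκ : κ ≠ 0)
    (h1234 : β a₁ b₁ * β a₂ b₂ - β a₁ a₂ * β b₁ b₂ + β a₁ b₂ * β b₁ a₂ = κ)
    (h1235 : β a₁ b₁ * β a₂ a₃ - β a₁ a₂ * β b₁ a₃ + β a₁ a₃ * β b₁ a₂ = 0)
    (h1236 : β a₁ b₁ * β a₂ b₃ - β a₁ a₂ * β b₁ b₃ + β a₁ b₃ * β b₁ a₂ = 0)
    (h1245 : β a₁ b₁ * β b₂ a₃ - β a₁ b₂ * β b₁ a₃ + β a₁ a₃ * β b₁ b₂ = 0)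
    (h1246 : β a₁ b₁ * β b₂ b₃ - β a₁ b₂ * β b₁ b₃ + β a₁ b₃ * β b₁ b₂ = 0)
    (h1256 : β a₁ b₁ * β a₃ b₃ - β a₁ a₃ * β b₁ b₃ + β a₁ b₃ * β b₁ a₃ = κ)
    (h1345 : β a₁ a₂ * β b₂ a₃ - β a₁ b₂ * β a₂ a₃ + β a₁ a₃ * β a₂ b₂ = 0)
    (h1346 : β a₁ a₂ * β b₂ b₃ - β a₁ b₂ * β a₂ b₃ + β a₁ b₃ * β a₂ b₂ = 0)
    (h1356 : β a₁ a₂ * β a₃ b₃ - β a₁ a₃ * β a₂ b₃ + β a₁ b₃ * β a₂ a₃ = 0)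
    (h1456 : β a₁ b₂ * β a₃ b₃ - β a₁ a₃ * β b₂ b₃ + β a₁ b₃ * β b₂ a₃ = 0)
    (h2345 : β b₁ a₂ * β b₂ a₃ - β b₁ b₂ * β a₂ a₃ + β b₁ a₃ * β a₂ b₂ = 0)
    (h2346 : β b₁ a₂ * β b₂ b₃ - β b₁ b₂ * β a₂ b₃ + β b₁ b₃ * β a₂ b₂ = 0)
    (h2356 : β b₁ a₂ * β a₃ b₃ - β b₁ a₃ * β a₂ b₃ + β b₁ b₃ * β a₂ a₃ = 0)
    (h2456 : β b₁ b₂ * β a₃ b₃ - β b₁ a₃ * β b₂ b₃ + β b₁ b₃ * β b₂ a₃ = 0)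
    (h3456 : β a₂ b₂ * β a₃ b₃ - β a₂ a₃ * β b₂ b₃ + β a₂ b₃ * β b₂ a₃ = κ) :
    β a₁ b₁ = β a₂ b₂ ∧ β a₂ b₂ = β a₃ b₃ ∧ κ = β a₁ b₁ ^ 2 := by
  obtain ⟨z13, z14, z15, z16, z23, z24, z25, z26, z35, z36, z45, z46⟩ :=
    cross_eq_zero_of_pfaffian_clique β a₁ b₁ a₂ b₂ a₃ b₃ κ hκ h1234 h1235 h1236 h1245 h1246 h1256
      h1345 h1346 h1356 h1456 h2345 h2346 h2356 h2456
  have p12 : β a₁ b₁ * β a₂ b₂ = κ := by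
    linear_combination h1234 + β b₁ b₂ * z13 - β b₁ a₂ * z14
  have p13 : β a₁ b₁ * β a₃ b₃ = κ := by
    linear_combination h1256 + β b₁ b₃ * z15 - β b₁ a₃ * z16
  have p23 : β a₂ b₂ * β a₃ b₃ = κ := by
    linear_combination h3456 + β b₂ b₃ * z35 - β b₂ a₃ * z36
  have n1 : β a₁ b₁ ≠ 0 := fun h0 => hκ (by rw [← p12, h0, zero_mul])
  have n3 : β a₃ b₃ ≠ 0 := fun h0 => hκ (by rw [← p13, h0, mul_zero])
  have d23 : β a₂ b₂ = β a₃ b₃ := mul_left_cancel₀ n1 (p12.trans p13.symm)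
  have d12 : β a₁ b₁ = β a₂ b₂ := mul_right_cancel₀ n3 (p13.trans p23.symm)
  refine ⟨d12, d23, ?_⟩
  rw [sq, ← p12, ← d12]

/-- **`K₃` needs a square.**  Under the `K₃` pattern of Pfaffian coordinates on six indices, `κ` is a
square in any domain (for `κ ≠ 0` by `diag_eq_of_pfaffian_clique`, trivially for `κ = 0`): for a
non-square unit `κ ∈ 𝔽_p`, `κ · D_m^[2]` (`m ≥ 3`, any number of slots) is not of the form `β^[2]` — the
`κ`-square test of the `p = 3` congruence tower (S4-PR-52; memo DUAL4-search-2-g10 §3). -/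
theorem isSquare_of_pfaffian_clique [NoZeroDivisors R] (β : ι → ι → R) (a₁ b₁ a₂ b₂ a₃ b₃ : ι) (κ : R)
    (h1234 : β a₁ b₁ * β a₂ b₂ - β a₁ a₂ * β b₁ b₂ + β a₁ b₂ * β b₁ a₂ = κ)
    (h1235 : β a₁ b₁ * β a₂ a₃ - β a₁ a₂ * β b₁ a₃ + β a₁ a₃ * β b₁ a₂ = 0)
    (h1236 : β a₁ b₁ * β a₂ b₃ - β a₁ a₂ * β b₁ b₃ + β a₁ b₃ * β b₁ a₂ = 0)
    (h1245 : β a₁ b₁ * β b₂ a₃ - β a₁ b₂ * β b₁ a₃ + β a₁ a₃ * β b₁ b₂ = 0)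
    (h1246 : β a₁ b₁ * β b₂ b₃ - β a₁ b₂ * β b₁ b₃ + β a₁ b₃ * β b₁ b₂ = 0)
    (h1256 : β a₁ b₁ * β a₃ b₃ - β a₁ a₃ * β b₁ b₃ + β a₁ b₃ * β b₁ a₃ = κ)
    (h1345 : β a₁ a₂ * β b₂ a₃ - β a₁ b₂ * β a₂ a₃ + β a₁ a₃ * β a₂ b₂ = 0)
    (h1346 : β a₁ a₂ * β b₂ b₃ - β a₁ b₂ * β a₂ b₃ + β a₁ b₃ * β a₂ b₂ = 0)
    (h1356 : β a₁ a₂ * β a₃ b₃ - β a₁ a₃ * β a₂ b₃ + β a₁ b₃ * β a₂ a₃ = 0)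
    (h1456 : β a₁ b₂ * β a₃ b₃ - β a₁ a₃ * β b₂ b₃ + β a₁ b₃ * β b₂ a₃ = 0)
    (h2345 : β b₁ a₂ * β b₂ a₃ - β b₁ b₂ * β a₂ a₃ + β b₁ a₃ * β a₂ b₂ = 0)
    (h2346 : β b₁ a₂ * β b₂ b₃ - β b₁ b₂ * β a₂ b₃ + β b₁ b₃ * β a₂ b₂ = 0)
    (h2356 : β b₁ a₂ * β a₃ b₃ - β b₁ a₃ * β a₂ b₃ + β b₁ b₃ * β a₂ a₃ = 0)
    (h2456 : β b₁ b₂ * β a₃ b₃ - β b₁ a₃ * β b₂ b₃ + β b₁ b₃ * β b₂ a₃ = 0)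
    (h3456 : β a₂ b₂ * β a₃ b₃ - β a₂ a₃ * β b₂ b₃ + β a₂ b₃ * β b₂ a₃ = κ) :
    IsSquare κ := by
  by_cases hκ : κ = 0
  · exact ⟨0, by rw [hκ, mul_zero]⟩
  · obtain ⟨-, -, hsq⟩ := diag_eq_of_pfaffian_clique β a₁ b₁ a₂ b₂ a₃ b₃ κ hκ h1234 h1235 h1236 h1245
      h1246 h1256 h1345 h1346 h1356 h1456 h2345 h2346 h2356 h2456 h3456
    exact ⟨β a₁ b₁, by rw [hsq, sq]⟩

end Sieve

end Summit.Ventures.HSemireg.DividedSquareLemma
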